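import Mathlib

/-!
# Stubs `stub_bimodalTiltCounterexample`, `stub_bimodalTiltBalanced` of line `crossing-split-integrability`
(crux `Summit.QuantumFields.QCD.Theses.PauliWegnerSea.PhaseQuenchedFlavourDecay`, item stmt-QuantumFields-9151)

**No universal tilted reverse Hölder without regularity of the prior (Mathlib only) — the negative
counterpart of `stub_tiltedRankOneMoment` (p139097).**

The open core of the line (`stub_minorMomentsCore` ≡ X = `UniformMinorMoments`) asks, for the
phase-quenched law `∏_f |det D_f|^{N} · μ_W`, that the fractional-moment datum `E₊[X^s] ≤ C`
(`s < 1`, the hypothesis UPPER at coincident points) control `E₊[X^{1+ε}]` for some `ε > 0`, with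
constants depending on `(N_f, s, C)` ONLY — uniformly over the coupling `β ∈ ℝ` and the masses, i.e.
uniformly over the PRIOR `μ_W`.  In the rank-one world `X = |(A + v E_xx)⁻¹_xx| ∝ 1/|det A + v c|`
and p139097 proves exactly such a universal bound when the single-site law of `v` is `U[-R, R]`
(tilt `|det|^N`, every `0 ≤ ε < N`, constants `K(N, ε, R)`).

This file records that the regularity of the single-site law is what pays: for the `1 × 1` matrix
`A = 0` (so `det (A + v) = v`, `(A + v)⁻¹ = 1/v`) and the TWO-POINT prior
`ν = (1 - p) δ₁ + p δ_η` on the coupling, the `|det|^N`-tilted law has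

* `s`-datum `∫ |v|^N |v|^{-s} dν / ∫ |v|^N dν ≤ 2`, but
* `(1+ε)`-moment `∫ |v|^N |v|^{-(1+ε)} dν / ∫ |v|^N dν ≥ K` for any prescribed `K`,

once `η` is small and the prior odds of the near-singular value are `p/(1-p) = η^{-(N-s)}`
(`stub_bimodalTiltCounterexample`, every `N : ℕ`, `0 < s < 1`, `0 < ε`).  For tilt power `N = 1`
BALANCED odds `p = 1/2` already suffice (`stub_bimodalTiltBalanced`): a prior under which the local
near-zero eigenvalue sits at scale `η → 0` with probability `1/2` and at scale `1` with probability
`1/2` keeps UPPER's datum bounded while every `(1+ε)`-moment diverges.  READING for the crux: the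
constants of X cannot be universal over priors; they must come from the regularity of the Wilson
prior UNIFORMLY in `β ∈ ℝ` — and the one place where that regularity degenerates with local
discrete freedom is measure concentration at `β → -∞` (nowhere-zero `Z₃` flux; crux NOTES.md, c8
addendum), where flavours WITHOUT a degenerate partner (`N = 1`) meet exactly the balanced scenario.
Two-point laws are used for transparency; smearing each atom into `U[a, a + η²]` changes nothing.
-/

noncomputable section

namespace Summit.QuantumFields.QCD.Cruxes.PhaseQuenchedFlavourDecay.CrossingSplitIntegrability

open MeasureTheory

/-- The two-point prior `(1 - p) δ₁ + p δ_η` is a probability measure for `0 ≤ p ≤ 1`. -/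
theorem bimodalTilt_isProbabilityMeasure {p η : ℝ} (hp0 : 0 ≤ p) (hp1 : p ≤ 1) :
    IsProbabilityMeasure (ENNReal.ofReal (1 - p) • Measure.dirac (1:ℝ) + ENNReal.ofReal p • Measure.dirac η) := by
  refine ⟨?_⟩
  simp only [Measure.coe_add, Measure.coe_smul, Pi.add_apply, Pi.smul_apply,
    measure_univ, smul_eq_mul, mul_one]
  rw [← ENNReal.ofReal_add (by linarith) hp0]
  simp

/-- Integration against the two-point prior. -/
theorem bimodalTilt_integral {p η : ℝ} (hp0 : 0 ≤ p) (hp1 : p ≤ 1) (f : ℝ → ℝ) :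
    ∫ v, f v ∂(ENNReal.ofReal (1 - p) • Measure.dirac (1:ℝ) + ENNReal.ofReal p • Measure.dirac η) = (1 - p) * f 1 + p * f η := by
  have hi : ∀ (a : ℝ) (c : ENNReal), c ≠ ⊤ → Integrable f (c • Measure.dirac a) := fun a c hc =>
    ((integrable_const (f a)).congr (ae_eq_dirac f).symm).smul_measure hc
  rw [integral_add_measure (hi 1 _ ENNReal.ofReal_ne_top) (hi η _ ENNReal.ofReal_ne_top),
    integral_smul_measure, integral_smul_measure, integral_dirac, integral_dirac,
    ENNReal.toReal_ofReal (by linarith), ENNReal.toReal_ofReal hp0, smul_eq_mul, smul_eq_mul]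

/-- The tilted moments of `1/|v|` under the two-point prior, in closed form. -/
theorem bimodalTilt_tiltedMoment {p η : ℝ} (hp0 : 0 ≤ p) (hp1 : p ≤ 1) (hη : 0 < η) (N : ℕ) (q : ℝ) :
    ∫ v, |v| ^ N * |v| ^ (-q) ∂(ENNReal.ofReal (1 - p) • Measure.dirac (1:ℝ) + ENNReal.ofReal p • Measure.dirac η) = (1 - p) + p * (η ^ N * η ^ (-q)) := by
  rw [bimodalTilt_integral hp0 hp1]
  simp [abs_of_pos hη]

/-- **`stub_bimodalTiltCounterexample`** — no universal tilted reverse Hölder without regularity of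
the prior.  For every tilt power `N`, every `0 < s < 1`, every `ε > 0` and every `K` there are
`p, η ∈ (0, 1)` such that under the two-point prior `ν = (1-p) δ₁ + p δ_η` (a probability measure)
the `|v|^N`-tilted `s`-moment of `1/|v|` is at most twice the tilt's mass while the tilted
`(1+ε)`-moment exceeds `K` times it. -/
theorem stub_bimodalTiltCounterexample :
    ∀ (N : ℕ) (s ε K : ℝ), 0 < s → s < 1 → 0 < ε →
      ∃ p η : ℝ, 0 < p ∧ p < 1 ∧ 0 < η ∧ η < 1 ∧
        IsProbabilityMeasure (ENNReal.ofReal (1 - p) • Measure.dirac (1:ℝ) + ENNReal.ofReal p • Measure.dirac η) ∧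
        ∫ v, |v| ^ N * |v| ^ (-s) ∂(ENNReal.ofReal (1 - p) • Measure.dirac (1:ℝ) + ENNReal.ofReal p • Measure.dirac η) ≤ 2 * ∫ v, |v| ^ N ∂(ENNReal.ofReal (1 - p) • Measure.dirac (1:ℝ) + ENNReal.ofReal p • Measure.dirac η) ∧
        K * ∫ v, |v| ^ N ∂(ENNReal.ofReal (1 - p) • Measure.dirac (1:ℝ) + ENNReal.ofReal p • Measure.dirac η) ≤
          ∫ v, |v| ^ N * |v| ^ (-(1 + ε)) ∂(ENNReal.ofReal (1 - p) • Measure.dirac (1:ℝ) + ENNReal.ofReal p • Measure.dirac η) := by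
  intro N s ε K hs hs1 hε
  -- choose η small: η^{s-1-ε}/2 ≥ K, i.e. η ≤ (2 max K 1)^{-1/(1+ε-s)}
  obtain ⟨η, hη0, hη1, hηK⟩ : ∃ η : ℝ, 0 < η ∧ η < 1 ∧ 2 * max K 1 ≤ η ^ (s - 1 - ε) := by
    set A : ℝ := 2 * max K 1 with hA
    have hA1 : 1 < A := by
      have := le_max_right K 1; rw [hA]; linarith
    have hA0 : 0 < A := by linarith
    have hex : 0 < 1 + ε - s := by linarith
    refine ⟨A ^ (-(1 / (1 + ε - s))), Real.rpow_pos_of_pos hA0 _, ?_, ?_⟩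
    · exact Real.rpow_lt_one_of_one_lt_of_neg hA1 (by
        have : 0 < 1 / (1 + ε - s) := by positivity
        linarith)
    · rw [← Real.rpow_mul hA0.le]
      have : -(1 / (1 + ε - s)) * (s - 1 - ε) = 1 := by field_simp; ring
      rw [this, Real.rpow_one]
  -- odds (1-p)/p = η^{N-s}:  p = 1/(1 + η^{N-s})
  set t : ℝ := η ^ (N : ℝ) * η ^ (-s) with ht
  have ht0 : 0 < t := by positivity
  set p : ℝ := 1 / (1 + t) with hp
  have hp0 : 0 < p := by positivity
  have hp1 : p < 1 := by
    rw [hp, div_lt_one (by positivity)]; linarith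
  have h1p : 1 - p = p * t := by
    rw [hp]; field_simp; ring
  refine ⟨p, η, hp0, hp1, hη0, hη1, bimodalTilt_isProbabilityMeasure hp0.le hp1.le, ?_, ?_⟩
  · -- s-moment: (1-p) + p η^N η^{-s} = 2 p t ≤ 2 ((1-p) + p η^N) since t ≤ ... we show p t ≤ (1-p) + p η^N
    rw [bimodalTilt_tiltedMoment hp0.le hp1.le hη0]
    have hmass : ∫ v, |v| ^ N ∂(ENNReal.ofReal (1 - p) • Measure.dirac (1:ℝ) + ENNReal.ofReal p • Measure.dirac η) = (1 - p) + p * η ^ N := by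
      rw [bimodalTilt_integral hp0.le hp1.le]; simp [abs_of_pos hη0]
    rw [hmass, h1p]
    have hN : (η : ℝ) ^ N = η ^ (N : ℝ) := (Real.rpow_natCast η N).symm
    rw [hN, ← ht]
    have : 0 ≤ p * η ^ (N : ℝ) := by positivity
    nlinarith
  · -- (1+ε)-moment: (1-p) + p η^N η^{-(1+ε)} ≥ p η^{N-1-ε} ≥ K (p t + p η^N) using η^{s-1-ε} ≥ 2 max K 1
    rw [bimodalTilt_tiltedMoment hp0.le hp1.le hη0]
    have hmass : ∫ v, |v| ^ N ∂(ENNReal.ofReal (1 - p) • Measure.dirac (1:ℝ) + ENNReal.ofReal p • Measure.dirac η) = (1 - p) + p * η ^ N := by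
      rw [bimodalTilt_integral hp0.le hp1.le]; simp [abs_of_pos hη0]
    rw [hmass, h1p]
    have hN : (η : ℝ) ^ N = η ^ (N : ℝ) := (Real.rpow_natCast η N).symm
    rw [hN]
    -- key: η^N η^{-(1+ε)} = η^{s-1-ε} * t  and  η^N ≤ t
    have hkey : η ^ (N : ℝ) * η ^ (-(1 + ε)) = η ^ (s - 1 - ε) * t := by
      rw [ht, ← Real.rpow_add hη0, ← Real.rpow_add hη0, ← Real.rpow_add hη0]; ring_nf
    have hNt : η ^ (N : ℝ) ≤ t := by
      rw [ht]
      have : (1 : ℝ) ≤ η ^ (-s) := Real.one_le_rpow_of_pos_of_le_one_of_nonpos hη0 hη1.le (by linarith)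
      have h0 : 0 ≤ η ^ (N : ℝ) := by positivity
      nlinarith
    rw [hkey]
    have hKle : K ≤ max K 1 := le_max_left K 1
    have hmax0 : 0 ≤ max K 1 := le_trans zero_le_one (le_max_right K 1)
    have hpt : 0 ≤ p * t := by positivity
    have hpN : 0 ≤ p * η ^ (N : ℝ) := by positivity
    -- K (p t + p η^N) ≤ max K 1 · 2 p t ≤ η^{s-1-ε} p t ≤ (1-p) + p η^{s-1-ε} t
    calc K * (p * t + p * η ^ (N : ℝ)) ≤ max K 1 * (p * t + p * η ^ (N : ℝ)) := by
          apply mul_le_mul_of_nonneg_right hKle; positivity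
      _ ≤ max K 1 * (2 * (p * t)) := by
          apply mul_le_mul_of_nonneg_left _ hmax0; nlinarith
      _ = (2 * max K 1) * (p * t) := by ring
      _ ≤ η ^ (s - 1 - ε) * (p * t) := mul_le_mul_of_nonneg_right hηK hpt
      _ ≤ p * t + p * (η ^ (s - 1 - ε) * t) := by nlinarith

/-- **`stub_bimodalTiltBalanced`** — balanced odds suffice for tilt power `N = 1`.  Under `ν = ½ δ₁ + ½ δ_η` the `|v|`-tilted
`s`-moment of `1/|v|` stays `≤ 2 ×` mass while the `(1+ε)`-moment is `≥ η^{-ε}/2 ×` mass — divergent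
for EVERY `ε > 0` as `η → 0`.  (The realisable scenario for a flavour without degenerate partner.) -/
theorem stub_bimodalTiltBalanced :
    ∀ (s ε η : ℝ), 0 < s → s < 1 → 0 < ε → 0 < η → η < 1 →
    ∫ v, |v| ^ (1:ℕ) * |v| ^ (-s) ∂(ENNReal.ofReal (1 - 1/2) • Measure.dirac (1:ℝ) + ENNReal.ofReal (1/2) • Measure.dirac η) ≤ 2 * ∫ v, |v| ^ (1:ℕ) ∂(ENNReal.ofReal (1 - 1/2) • Measure.dirac (1:ℝ) + ENNReal.ofReal (1/2) • Measure.dirac η) ∧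
      η ^ (-ε) / 4 * ∫ v, |v| ^ (1:ℕ) ∂(ENNReal.ofReal (1 - 1/2) • Measure.dirac (1:ℝ) + ENNReal.ofReal (1/2) • Measure.dirac η) ≤
        ∫ v, |v| ^ (1:ℕ) * |v| ^ (-(1 + ε)) ∂(ENNReal.ofReal (1 - 1/2) • Measure.dirac (1:ℝ) + ENNReal.ofReal (1/2) • Measure.dirac η) := by
  intro s ε η hs hs1 hε hη0 hη1
  have h0 : (0:ℝ) ≤ 1/2 := by norm_num
  have h1 : (1:ℝ)/2 ≤ 1 := by norm_num
  have hmass : ∫ v, |v| ^ (1:ℕ) ∂(ENNReal.ofReal (1 - 1/2) • Measure.dirac (1:ℝ) + ENNReal.ofReal (1/2) • Measure.dirac η) = 1/2 + 1/2 * η := by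
    rw [bimodalTilt_integral h0 h1]; simp [abs_of_pos hη0]; ring
  rw [bimodalTilt_tiltedMoment h0 h1 hη0, bimodalTilt_tiltedMoment h0 h1 hη0, hmass]
  have hηs : η ^ (1:ℕ) * η ^ (-s) ≤ 1 := by
    rw [pow_one, ← Real.rpow_one_add' hη0.le (by linarith : (1:ℝ) + -s ≠ 0)]
    exact Real.rpow_le_one hη0.le hη1.le (by linarith)
  have hηe : η ^ (1:ℕ) * η ^ (-(1 + ε)) = η ^ (-ε) := by
    rw [pow_one, ← Real.rpow_one_add' hη0.le (by linarith : (1:ℝ) + -(1 + ε) ≠ 0)]; ring_nf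
  have hε0 : 0 ≤ η ^ (-ε) := by positivity
  constructor
  · nlinarith
  · rw [hηe]; nlinarith

end Summit.QuantumFields.QCD.Cruxes.PhaseQuenchedFlavourDecay.CrossingSplitIntegrability
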